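/-
# Solo-blind programme on Kontsevich–Zagier, s6 part T4b: the five-term relation, II — the twist

Second step of the five-term relation inside KZ's rules (see `SoloBlindFiveTermWedge`).  For cuts
`x, y` the **twisted cut** is `x ⋆ y = x(1−y)/(1−xy) ∈ (0,1)` (`Cut.twist`; note
`y(1−x)/(1−xy) = y ⋆ x`, so the five arguments of the relation are `x, y, xy, x ⋆ y, y ⋆ x`).
The rational chart

  `Ξ(t₀, t₁) = (t₀ ⋆ y, (t₁ − y t₀)/(1 − y t₀))`   (Jacobian `(1−y)/(1−y t₀)³`)

maps the wedge `V = {y t₀ < t₁ < t₀ < x}` onto the triangle of `D(x ⋆ y)` and pulls the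
dilogarithm form back to `ξ = dt/(t₀(1−t₁)(1−y t₀))` (`xiRep_equiv`, rule 2); on the wedge
`ξ − dt/(t₀(1−t₁)) = θ := y·dt/((1−y t₀)(1−t₁))` (rule 1b), whence

  `[V, θ] = [D(x ⋆ y)] − [D(x)] + [D(xy)]`   in `Q`   (`mkQ_thetaRep`).

All coefficients are algebraic (`y`), so every set, function and map is `ℚ`-semialgebraic.
-/
import Summits.KontsevichZagierPeriods.KontsevichZagierPeriods.Theorems.SoloBlindFiveTermWedge

noncomputable section

open MeasureTheory Set MvPolynomial
open Literature.NumberTheory.Transcendental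
open Literature.NumberTheory.Transcendental.KZ
open Literature.NumberTheory.Transcendental.KZ.IntegralRep
open Literature.ModelTheory.ExponentialFields (IsSemialgebraic isSemialgebraic_setOf_eval_pos)

namespace Summit.KontsevichZagierPeriods.KontsevichZagierPeriods.Theorems

namespace SoloBlind

/-! ## The twist coordinate `r ↦ r(1−y)/(1−yr)` and its inverse -/

/-- `d/dr [r/(1−yr)] = 1/(1−yr)²`. -/
theorem hasDerivAt_twistCoord {y r : ℝ} (hr : 1 - y * r ≠ 0) :
    HasDerivAt (fun r : ℝ => r * (1 - y * r)⁻¹) ((1 - y * r) ^ 2)⁻¹ r := by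
  have h1 : HasDerivAt (fun r : ℝ => 1 - y * r) (-y) r := by
    simpa using ((hasDerivAt_id' r).const_mul y).const_sub 1
  have h2 : HasDerivAt (fun s : ℝ => s * (1 - y * s)⁻¹)
      (1 * (1 - y * r)⁻¹ + r * (-(-y) / (1 - y * r) ^ 2)) r := (hasDerivAt_id' r).mul (h1.inv hr)
  refine h2.congr_deriv ?_
  field_simp
  ring

/-- `d/dr [1/(1−yr)] = y/(1−yr)²`. -/
theorem hasDerivAt_inv_twistDen {y r : ℝ} (hr : 1 - y * r ≠ 0) :
    HasDerivAt (fun r : ℝ => (1 - y * r)⁻¹) (y * ((1 - y * r) ^ 2)⁻¹) r := by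
  have h1 : HasDerivAt (fun r : ℝ => 1 - y * r) (-y) r := by
    simpa using ((hasDerivAt_id' r).const_mul y).const_sub 1
  refine (h1.inv hr).congr_deriv ?_
  field_simp

/-- The twist coordinate is strictly increasing where its denominator is positive. -/
theorem twistCoord_lt {y r r' : ℝ} (hy : y < 1) (hr' : 0 < 1 - y * r') (hr : 0 < 1 - y * r)
    (h : r < r') : r * (1 - y) * (1 - y * r)⁻¹ < r' * (1 - y) * (1 - y * r')⁻¹ := by
  rw [← div_eq_mul_inv, ← div_eq_mul_inv, div_lt_div_iff₀ hr hr']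
  nlinarith

/-- The inverse twist coordinate `t ↦ t/(1−y+yt)` is strictly increasing (`0 ≤ y < 1`, `t ≥ 0`). -/
theorem invTwist_lt {y t t' : ℝ} (hy0 : 0 ≤ y) (hy : y < 1) (ht : 0 ≤ t) (ht' : 0 ≤ t')
    (h : t < t') : t * (1 - y + y * t)⁻¹ < t' * (1 - y + y * t')⁻¹ := by
  have h1 : 0 < 1 - y + y * t := by nlinarith [mul_nonneg hy0 ht]
  have h2 : 0 < 1 - y + y * t' := by nlinarith [mul_nonneg hy0 ht']
  rw [← div_eq_mul_inv, ← div_eq_mul_inv, div_lt_div_iff₀ h1 h2]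
  nlinarith

/-- Twisting the inverse twist returns the point. -/
theorem twistCoord_invTwist {y t : ℝ} (h1 : 1 - y + y * t ≠ 0) (hy : 1 - y ≠ 0) :
    t * (1 - y + y * t)⁻¹ * (1 - y) * (1 - y * (t * (1 - y + y * t)⁻¹))⁻¹ = t := by
  have h2 : 1 - y * (t * (1 - y + y * t)⁻¹) = (1 - y) * (1 - y + y * t)⁻¹ := by
    field_simp
    ring
  rw [h2, mul_inv, inv_inv]
  calc t * (1 - y + y * t)⁻¹ * (1 - y) * ((1 - y)⁻¹ * (1 - y + y * t))
      = t * ((1 - y) * (1 - y)⁻¹) * ((1 - y + y * t)⁻¹ * (1 - y + y * t)) := by ring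
    _ = t := by rw [mul_inv_cancel₀ hy, inv_mul_cancel₀ h1, mul_one, mul_one]

/-- Untwisting the twist returns the point. -/
theorem invTwist_twistCoord {y r : ℝ} (hd : 1 - y * r ≠ 0) (hy : 1 - y ≠ 0) :
    r * (1 - y) * (1 - y * r)⁻¹ * (1 - y + y * (r * (1 - y) * (1 - y * r)⁻¹))⁻¹ = r := by
  have h2 : 1 - y + y * (r * (1 - y) * (1 - y * r)⁻¹) = (1 - y) * (1 - y * r)⁻¹ := by
    field_simp
    ring
  rw [h2, mul_inv, inv_inv]
  calc r * (1 - y) * (1 - y * r)⁻¹ * ((1 - y)⁻¹ * (1 - y * r))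
      = r * ((1 - y) * (1 - y)⁻¹) * ((1 - y * r)⁻¹ * (1 - y * r)) := by ring
    _ = r := by rw [mul_inv_cancel₀ hy, inv_mul_cancel₀ hd, mul_one, mul_one]

/-! ## The twisted cut -/

namespace Cut

variable (a c : Cut)

/-- **The twisted cut** `x ⋆ y = x(1−y)/(1−xy)`. -/
def twist : Cut := ⟨a.x * (1 - c.x) * (1 - c.x * a.x)⁻¹,
  (a.alg.mul (isAlgebraic_one.sub c.alg)).mul (isAlgebraic_one.sub (c.alg.mul a.alg)).inv,
  mul_pos (mul_pos a.pos c.symm_pos) (inv_pos.2 (by nlinarith [a.pos, a.lt_one, c.pos, c.lt_one])),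
  by
    have h : 0 < 1 - c.x * a.x := by nlinarith [a.pos, a.lt_one, c.pos, c.lt_one]
    rw [mul_inv_lt_iff₀ h]
    nlinarith [a.lt_one, c.pos]⟩

/-- Its point. -/
theorem twist_x : (a.twist c).x = a.x * (1 - c.x) * (1 - c.x * a.x)⁻¹ := rfl

/-- `1 − y·x > 0` for cuts. -/
theorem twistDen_pos : 0 < 1 - c.x * a.x := by nlinarith [a.pos, a.lt_one, c.pos, c.lt_one]

end Cut

variable (a c : Cut)

/-- On the wedge `1 − y t₀ > 0`. -/
theorem twistDen_pos_of_mem {p : Fin 2 → ℝ} (hp : p ∈ ftWedgeDom a c) : 0 < 1 - c.x * p 0 := by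
  obtain ⟨h0, _, _, h3⟩ := hp
  nlinarith [c.pos, c.lt_one, a.lt_one]

/-! ## The chart `Ξ` -/

/-- `Ξ(t₀, t₁) = (t₀(1−y)/(1−y t₀), (t₁ − y t₀)/(1 − y t₀))`. -/
def xiChart (p : Fin 2 → ℝ) : Fin 2 → ℝ :=
  ![p 0 * (1 - c.x) * (1 - c.x * p 0)⁻¹, (p 1 - c.x * p 0) * (1 - c.x * p 0)⁻¹]

/-- `DΞ(t)`, lower triangular. -/
def xiDeriv (p : Fin 2 → ℝ) : (Fin 2 → ℝ) →L[ℝ] (Fin 2 → ℝ) :=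
  ContinuousLinearMap.pi ![((1 - c.x) * ((1 - c.x * p 0) ^ 2)⁻¹) • pr2 0,
    (c.x * (p 1 - 1) * ((1 - c.x * p 0) ^ 2)⁻¹) • pr2 0 + (1 - c.x * p 0)⁻¹ • pr2 1]

/-- `Ξ` has the stated derivative off `{1 − y t₀ = 0}`. -/
theorem hasFDerivAt_xiChart {p : Fin 2 → ℝ} (hp : 1 - c.x * p 0 ≠ 0) :
    HasFDerivAt (xiChart c) (xiDeriv c p) p := by
  have hπ0 : HasFDerivAt (fun q : Fin 2 → ℝ => q 0) (pr2 0) p := hasFDerivAt_apply 0 p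
  have hπ1 : HasFDerivAt (fun q : Fin 2 → ℝ => q 1) (pr2 1) p := hasFDerivAt_apply 1 p
  rw [hasFDerivAt_pi']
  refine Fin.forall_fin_two.mpr ⟨?_, ?_⟩
  · have hfun : (fun q : Fin 2 → ℝ => xiChart c q 0) =
        fun q => (1 - c.x) * (q 0 * (1 - c.x * q 0)⁻¹) := by
      funext q; simp only [xiChart, Matrix.cons_val_zero]; ring
    rw [hfun]
    have h := ((hasDerivAt_twistCoord hp).hasFDerivAt.comp p hπ0).const_mul (1 - c.x)
    refine h.congr_fderiv (ContinuousLinearMap.ext fun v => ?_)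
    simp [xiDeriv]
    ring
  · have hfun : (fun q : Fin 2 → ℝ => xiChart c q 1) =
        fun q => (q 1 - c.x * q 0) * (1 - c.x * q 0)⁻¹ := by
      funext q; simp [xiChart]
    rw [hfun]
    have hA : HasFDerivAt (fun q : Fin 2 → ℝ => q 1 - c.x * q 0) (pr2 1 - c.x • pr2 0) p :=
      hπ1.sub (hπ0.const_mul c.x)
    have hB := (hasDerivAt_inv_twistDen hp).hasFDerivAt.comp p hπ0
    refine (hA.mul hB).congr_fderiv (ContinuousLinearMap.ext fun v => ?_)
    simp [xiDeriv]
    field_simp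
    ring

/-- The matrix of `DΞ(t)`. -/
theorem toMatrix_xiDeriv (p : Fin 2 → ℝ) :
    LinearMap.toMatrix' ((xiDeriv c p : (Fin 2 → ℝ) →L[ℝ] (Fin 2 → ℝ)) :
      (Fin 2 → ℝ) →ₗ[ℝ] (Fin 2 → ℝ)) = !![(1 - c.x) * ((1 - c.x * p 0) ^ 2)⁻¹, 0;
        c.x * (p 1 - 1) * ((1 - c.x * p 0) ^ 2)⁻¹, (1 - c.x * p 0)⁻¹] := by
  ext i j
  rw [LinearMap.toMatrix'_apply, ContinuousLinearMap.coe_coe]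
  fin_cases i <;> fin_cases j <;> simp [xiDeriv]

/-- `|det DΞ(t)| = (1−y)/(1−y t₀)³`. -/
theorem abs_det_xiDeriv {p : Fin 2 → ℝ} (hp : 0 < 1 - c.x * p 0) :
    |(xiDeriv c p).det| = (1 - c.x) * ((1 - c.x * p 0) ^ 3)⁻¹ := by
  rw [ContinuousLinearMap.det, ← LinearMap.det_toMatrix', toMatrix_xiDeriv, Matrix.det_fin_two_of]
  simp only [zero_mul, sub_zero]
  rw [abs_of_pos (mul_pos (mul_pos c.symm_pos (inv_pos.2 (pow_pos hp 2))) (inv_pos.2 hp)),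
    mul_assoc, ← mul_inv, ← pow_succ]

/-- `Ξ` is injective on the wedge. -/
theorem injOn_xiChart : InjOn (xiChart c) (ftWedgeDom a c) := by
  intro p hp p' hp' h
  have hd := (twistDen_pos_of_mem a c hp).ne'
  have hd' := (twistDen_pos_of_mem a c hp').ne'
  have hy := c.symm_pos.ne'
  have h0 := congrFun h 0
  have h1 := congrFun h 1
  simp only [xiChart, Matrix.cons_val_zero, Matrix.cons_val_one] at h0 h1
  have e0 : p 0 = p' 0 := by
    rw [← div_eq_mul_inv, ← div_eq_mul_inv, div_eq_div_iff hd hd'] at h0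
    have h2 : (p 0 - p' 0) * (1 - c.x) = 0 := by linear_combination h0
    rcases mul_eq_zero.1 h2 with h3 | h3
    · linarith
    · exact absurd h3 hy
  rw [e0, ← div_eq_mul_inv, ← div_eq_mul_inv, div_left_inj' hd'] at h1
  funext i
  fin_cases i
  · exact e0
  · show p 1 = p' 1
    linarith

/-- `Ξ(V) = D(x ⋆ y)`. -/
theorem image_xiChart : xiChart c '' ftWedgeDom a c = cutDom (a.twist c) := by
  have hy := c.pos
  have hy1 := c.lt_one
  ext u
  simp only [mem_image, ftWedgeDom, cutDom, Cut.twist_x, mem_setOf_eq]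
  constructor
  · rintro ⟨p, hp, rfl⟩
    have hd := twistDen_pos_of_mem a c hp
    obtain ⟨h0, h1, h2, h3⟩ := hp
    simp only [xiChart, Matrix.cons_val_zero, Matrix.cons_val_one]
    refine ⟨mul_pos (by linarith) (inv_pos.2 hd), ?_, twistCoord_lt hy1 (a.twistDen_pos c) hd h3⟩
    rw [mul_lt_mul_iff_of_pos_right (inv_pos.2 hd)]
    nlinarith
  · rintro ⟨h1, h2, h3⟩
    set x : ℝ := u 0 * (1 - c.x + c.x * u 0)⁻¹ with hx
    have hu0 : 0 < u 0 := h1.trans h2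
    have hden : 0 < 1 - c.x + c.x * u 0 := by nlinarith
    have hx0 : 0 < x := mul_pos hu0 (inv_pos.2 hden)
    have hxa : x < a.x := by
      have e : a.x = (a.twist c).x * (1 - c.x + c.x * (a.twist c).x)⁻¹ := by
        rw [Cut.twist_x, invTwist_twistCoord (a.twistDen_pos c).ne' c.symm_pos.ne']
      rw [hx, e]
      exact invTwist_lt hy.le hy1 hu0.le (a.twist c).pos.le h3
    have hd : 0 < 1 - c.x * x := by nlinarith [a.lt_one]
    have htw : x * (1 - c.x) * (1 - c.x * x)⁻¹ = u 0 :=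
      twistCoord_invTwist hden.ne' c.symm_pos.ne'
    refine ⟨![x, c.x * x + u 1 * (1 - c.x * x)], ⟨hx0, ?_, ?_, hxa⟩, ?_⟩
    · show c.x * x < c.x * x + u 1 * (1 - c.x * x)
      nlinarith
    · show c.x * x + u 1 * (1 - c.x * x) < x
      have h4 : u 1 * (1 - c.x * x) < u 0 * (1 - c.x * x) := mul_lt_mul_of_pos_right h2 hd
      have h5 : u 0 * (1 - c.x * x) = x * (1 - c.x) := by
        rw [← htw, mul_assoc, inv_mul_cancel₀ hd.ne', mul_one]
      nlinarith
    · funext i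
      fin_cases i
      · exact htw
      · show (c.x * x + u 1 * (1 - c.x * x) - c.x * x) * (1 - c.x * x)⁻¹ = u 1
        field_simp
        ring

/-- `Ξ` is `ℚ`-semialgebraic (rational with the algebraic coefficient `y`). -/
theorem isSemialgebraicMapOn_xiChart : IsSemialgebraicMapOn ℚ (ftWedgeDom a c) (xiChart c) := by
  have hS := isSemialgebraic_ftWedgeDom a c
  have hden : IsSemialgebraicFunOn ℚ (ftWedgeDom a c) fun p => 1 - c.x * p 0 :=
    (IsSemialgebraicFunOn.sub_holds (isSemialgebraicFunOn_const_of_isAlgebraic hS isAlgebraic_one)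
      (isSemialgebraicFunOn_mul_apply c hS)).congr fun p _ => by simp
  have hne : ∀ p ∈ ftWedgeDom a c, 1 - c.x * p 0 ≠ 0 := fun p hp => (twistDen_pos_of_mem a c hp).ne'
  refine IsSemialgebraicMapOn.of_forall hS fun i => ?_
  fin_cases i
  · exact ((IsSemialgebraicFunOn.mul_holds (isSemialgebraicFunOn_aeval hS (X 0))
      (isSemialgebraicFunOn_const_of_isAlgebraic hS (isAlgebraic_one.sub c.alg))).div hden
        hne).congr fun p _ => by simp [xiChart, div_eq_mul_inv]
  · exact ((IsSemialgebraicFunOn.sub_holds (isSemialgebraicFunOn_aeval hS (X 1))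
      (isSemialgebraicFunOn_mul_apply c hS)).div hden hne).congr fun p _ => by
        simp [xiChart, div_eq_mul_inv]

/-! ## The pulled-back form `ξ` and the form `θ` on the wedge -/

/-- `ξ = 1/(t₀(1−t₁)(1−y t₀))`. -/
def xiFun (p : Fin 2 → ℝ) : ℝ := 1 / (p 0 * (1 - p 1) * (1 - c.x * p 0))

/-- `θ = y/((1−y t₀)(1−t₁))`. -/
def thetaFun (p : Fin 2 → ℝ) : ℝ := c.x / ((1 - c.x * p 0) * (1 - p 1))

/-- On the wedge: `ξ = (dilogFun ∘ Ξ) · |det DΞ|`. -/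
theorem xiFun_eq {p : Fin 2 → ℝ} (hp : p ∈ ftWedgeDom a c) :
    xiFun c p = dilogFun (xiChart c p) * ((1 - c.x) * ((1 - c.x * p 0) ^ 3)⁻¹) := by
  have hd := (twistDen_pos_of_mem a c hp).ne'
  obtain ⟨h0, h1, h2, h3⟩ := hp
  have hp0 : p 0 ≠ 0 := h0.ne'
  have hp1 : 1 - p 1 ≠ 0 := by linarith [a.lt_one]
  have hy : 1 - c.x ≠ 0 := c.symm_pos.ne'
  have hd' : 1 - p 0 * c.x ≠ 0 := by rwa [mul_comm] at hd
  have h2 : 1 - (p 1 - c.x * p 0) * (1 - c.x * p 0)⁻¹ = (1 - p 1) * (1 - c.x * p 0)⁻¹ := by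
    field_simp
    ring
  simp only [xiFun, dilogFun, xiChart, Matrix.cons_val_zero, Matrix.cons_val_one]
  rw [h2]
  field_simp

/-- On the wedge: `ξ = dilogFun + θ` (rule 1b). -/
theorem xiFun_eq_add {p : Fin 2 → ℝ} (hp : p ∈ ftWedgeDom a c) :
    xiFun c p = dilogFun p + thetaFun c p := by
  have hd := (twistDen_pos_of_mem a c hp).ne'
  obtain ⟨h0, h1, h2, h3⟩ := hp
  have hp0 : p 0 ≠ 0 := h0.ne'
  have hp1 : 1 - p 1 ≠ 0 := by linarith [a.lt_one]
  have hd' : 1 - p 0 * c.x ≠ 0 := by rwa [mul_comm] at hd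
  simp only [xiFun, dilogFun, thetaFun]
  field_simp
  ring

/-- The wedge denominators. -/
theorem wedge_ne_zero {p : Fin 2 → ℝ} (hp : p ∈ ftWedgeDom a c) :
    p 0 ≠ 0 ∧ 1 - p 1 ≠ 0 ∧ 1 - c.x * p 0 ≠ 0 := by
  have hd := (twistDen_pos_of_mem a c hp).ne'
  obtain ⟨h0, h1, h2, h3⟩ := hp
  exact ⟨h0.ne', by linarith [a.lt_one], hd⟩

/-- `1 − y t₀` is semialgebraic on the wedge. -/
theorem isSemialgebraicFunOn_twistDen :
    IsSemialgebraicFunOn ℚ (ftWedgeDom a c) fun p => 1 - c.x * p 0 :=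
  (IsSemialgebraicFunOn.sub_holds
    (isSemialgebraicFunOn_const_of_isAlgebraic (isSemialgebraic_ftWedgeDom a c) isAlgebraic_one)
    (isSemialgebraicFunOn_mul_apply c (isSemialgebraic_ftWedgeDom a c))).congr fun p _ => by simp

/-- **The representation `[V, ξ]`**; convergence is transported from `D(x ⋆ y)` along `Ξ`. -/
def xiRep : IntegralRep 2 where
  domain := ftWedgeDom a c
  integrand := xiFun c
  isSemialgebraic_domain := isSemialgebraic_ftWedgeDom a c
  isSemialgebraicFunOn_integrand := by
    have hS := isSemialgebraic_ftWedgeDom a c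
    exact ((isSemialgebraicFunOn_const_of_isAlgebraic hS isAlgebraic_one).div
      (IsSemialgebraicFunOn.mul_holds (isSemialgebraicFunOn_aeval hS (X 0 * (1 - X 1)))
        (isSemialgebraicFunOn_twistDen a c)) fun p hp => by
          obtain ⟨h0, h1, h2⟩ := wedge_ne_zero a c hp
          simpa using mul_ne_zero (mul_ne_zero h0 h1) h2).congr fun p _ => by simp [xiFun]
  integrableOn :=
    (integrableOn_iff_of_chart
        (IsSemialgebraic.measurableSet_holds (isSemialgebraic_ftWedgeDom a c))
        (fun _ hp => hasFDerivAt_xiChart c (twistDen_pos_of_mem a c hp).ne') (injOn_xiChart a c)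
        (J := fun p => (1 - c.x) * ((1 - c.x * p 0) ^ 3)⁻¹) (f := xiFun c) (g := dilogFun)
        (fun _ hp => abs_det_xiDeriv c (twistDen_pos_of_mem a c hp))
        (fun _ hp => xiFun_eq a c hp)).mp
      (by rw [image_xiChart a c]; exact (dilogCut _).integrableOn)

/-- **The representation `[V, θ]`** (`θ = ξ − dilogFun` is integrable as a difference). -/
def thetaRep : IntegralRep 2 where
  domain := ftWedgeDom a c
  integrand := thetaFun c
  isSemialgebraic_domain := isSemialgebraic_ftWedgeDom a c
  isSemialgebraicFunOn_integrand := by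
    have hS := isSemialgebraic_ftWedgeDom a c
    exact ((isSemialgebraicFunOn_const_of_isAlgebraic hS c.alg).div
      (IsSemialgebraicFunOn.mul_holds (isSemialgebraicFunOn_twistDen a c)
        (isSemialgebraicFunOn_aeval hS (1 - X 1))) fun p hp => by
          obtain ⟨_, h1, h2⟩ := wedge_ne_zero a c hp
          simpa using mul_ne_zero h2 h1).congr fun p _ => by simp [thetaFun]
  integrableOn :=
    (integrableOn_congr_fun (fun p hp => by
        show xiFun c p - dilogFun p = thetaFun c p
        rw [xiFun_eq_add a c hp, add_sub_cancel_left])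
      (IsSemialgebraic.measurableSet_holds (isSemialgebraic_ftWedgeDom a c))).mp
      ((xiRep a c).integrableOn.sub (ftWedge a c).integrableOn)

/-- **Chart move.** `[V, ξ] ≡ D(x ⋆ y)`. -/
theorem xiRep_equiv : Equivalent (xiRep a c) (dilogCut (a.twist c)) :=
  equivalent_of_chart (isSemialgebraicMapOn_xiChart a c)
    (fun _ hp => hasFDerivAt_xiChart c (twistDen_pos_of_mem a c hp).ne') (injOn_xiChart a c)
    (image_xiChart a c) (J := fun p => (1 - c.x) * ((1 - c.x * p 0) ^ 3)⁻¹)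
    (fun _ hp => abs_det_xiDeriv c (twistDen_pos_of_mem a c hp)) (fun _ hp => xiFun_eq a c hp)
    rfl (fun _ _ => rfl) rfl (fun _ _ => rfl)

/-- **Integrand split.** `[V, ξ] − [V, dilogFun] − [V, θ]` is a relation. -/
theorem xiRep_split : of (xiRep a c) - of (ftWedge a c) - of (thetaRep a c) ∈ relations :=
  integrandAddRel_subset_relations ⟨2, xiRep a c, ftWedge a c, thetaRep a c, rfl, rfl,
    fun _ hp => xiFun_eq_add a c hp, rfl⟩

/-- **`[V, θ] = [D(x ⋆ y)] − [D(x)] + [D(xy)]`** in `Q`. -/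
theorem mkQ_thetaRep : mkQ (of (thetaRep a c)) =
    mkQ (of (dilogCut (a.twist c))) - mkQ (of (dilogCut a)) + mkQ (of (dilogCut (a.mul c))) := by
  have key : mkQ (of (thetaRep a c)) + mkQ (of (ftWedge a c)) =
      mkQ (of (dilogCut (a.twist c))) := by
    rw [← map_add, mkQ_eq_mkQ_iff]
    have e : of (thetaRep a c) + of (ftWedge a c) - of (dilogCut (a.twist c)) =
        -(of (xiRep a c) - of (ftWedge a c) - of (thetaRep a c)) +
          (of (xiRep a c) - of (dilogCut (a.twist c))) := by abel
    rw [e]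
    exact add_mem (neg_mem (xiRep_split a c)) (xiRep_equiv a c)
  rw [mkQ_ftWedge] at key
  linear_combination key

end SoloBlind

end Summit.KontsevichZagierPeriods.KontsevichZagierPeriods.Theorems
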